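import Summits.Parity.GeneralizedHardyLittlewood.Theorems.BeyondDiagonalBeatsQuarter.MellinBumpCoprimeC1
import HarnessLib

/-!
# Route `PrimeLevelFamEdge`, crux K_B (stmt-Parity-20343), line `diagonal_kernel_split` rev 4, plan Ω —
# **the divisor-layer mollifier coefficients in C1 currency**: `c_{dm} = A_d(M)·(𝟙[(m,d)=1]W(m)·λ_{M/d}(m))·√m`
# (glue between `levelBody`'s `Σ_{l: d∣l} c_l …` and `MellinBumpCoprimeC1.mellinBump_coprime_bv`)

In the off-diagonal core the pair sum of a divisor layer `(d₁,d₂)` runs over `l = d₁a`, `m = d₂b` with the KMV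
coefficients `c_n = mollifierCoeff X² M n = μ(n)ψ(n)⁻¹n^{−1/2}(log(M/n)/log M)²`. This file rewrites them in the currency
of the divisor-layer C1 (`mellinBump_coprime_bv`: weights `(𝟙[(m,d)=1]·W(m))·logWeight (M/d) m`, two lengths `M/d_i`):

* `psi_mul_of_coprime` — `ψ(dm) = ψ(d)ψ(m)` for `(d,m) = 1`;
* `not_squarefree_mul_of_not_coprime` — `(m,d) ≠ 1 ⇒ μ(dm) = 0`;
* **`mollifierCoeff_X_sq_mul_eq`** — for `d, m ≥ 1`, `m ≤ ⌊M/d⌋`, `log(M/d) ≠ 0`: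
  `c_{dm}(M) = (μ(d)ψ(d)⁻¹d^{−1/2}(log(M/d)/log M)²) · ((𝟙[(m,d)=1]W(m))·logWeight (M/d) m) · √m`;
* **`sum_filter_dvd_mollifierCoeff_eq`** — `Σ_{l≤⌊M⌋, d∣l} c_l·F(l) = A_d(M)·Σ_{m≤⌊M/d⌋} (𝟙W·λ_{M/d})(m)·(√m·F(dm))`;
* **`sum_sum_filter_dvd_mollifierCoeff_eq`** — the pair form for a layer `(d₁,d₂)`: exactly the double sum of
  `mellinBump_coprime_bv` (`M_i = M/d_i`) against the product-window `√(ab)·F(d₁a·d₂b)`.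

Theorems only; standard axioms. Helper toward `stub_offDiagBelowSlack_io`; closes nothing.
«The programme SEARCHES and TYPES; no claim about Landau–Siegel zeros, Theorems 1–2 of arXiv:2211.02515 or
a repaired Margin232 until a kernel theorem says so.»
-/

noncomputable section

open scoped Real ArithmeticFunction.Moebius
open Finset ArithmeticFunction Polynomial

namespace Summit.Parity.GeneralizedHardyLittlewood.Theorems.BeyondDiagonalBeatsQuarter.MellinBump

open Literature.NumberTheory.LFunctions Literature.NumberTheory.LFunctions.KMV2000
open MollifierMainTerm (W)
open KernelFormXSq

/-- `ψ` is multiplicative on coprime arguments: `ψ(dm) = ψ(d)ψ(m)`. [cite: KowalskiMichelVanderKam2000, (8) p. 7 — derivation] -/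
theorem psi_mul_of_coprime {d m : ℕ} (hd : d ≠ 0) (hm : m ≠ 0) (h : d.Coprime m) :
    psi (d * m) = psi d * psi m := by
  unfold psi
  rw [Nat.primeFactors_mul hd hm, Finset.prod_union h.disjoint_primeFactors]

/-- A common prime factor kills `μ`: `(m,d) ≠ 1 ⇒ ¬ Squarefree (d·m)`. [folklore] -/
theorem not_squarefree_mul_of_not_coprime {d m : ℕ} (h : ¬ m.Coprime d) : ¬ Squarefree (d * m) := by
  intro hsq
  obtain ⟨p, hp, hpm, hpd⟩ := Nat.Prime.not_coprime_iff_dvd.1 h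
  obtain ⟨a, rfl⟩ := hpd
  obtain ⟨b, rfl⟩ := hpm
  have : p * p ∣ p * a * (p * b) := ⟨a * b, by ring⟩
  exact hp.not_isUnit (hsq p this)

/-- **The divisor-layer coefficient in C1 currency.** For `d, m ≥ 1`, `m ≤ ⌊M/d⌋` and `log(M/d) ≠ 0`:
`c_{dm}(M) = (μ(d)ψ(d)⁻¹d^{−1/2}(log(M/d)/log M)²)·((𝟙[(m,d)=1]W(m))·logWeight (M/d) m)·√m`
(`μ(dm) = μ(d)μ(m)𝟙[(m,d)=1]`, `ψ(dm) = ψ(d)ψ(m)`, `(dm)^{−1/2} = d^{−1/2}m^{−1/2}`, `W(m)√m = μ(m)ψ(m)⁻¹m^{−1/2}`).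
[cite: KowalskiMichelVanderKam2000, (9) p. 7 — derivation] -/
theorem mollifierCoeff_X_sq_mul_eq {M : ℝ} {d m : ℕ} (hd : 1 ≤ d) (hm : 1 ≤ m) (hmM : m ≤ ⌊M / d⌋₊)
    (hMd : Real.log (M / d) ≠ 0) :
    mollifierCoeff (X ^ 2) M (d * m) =
      ((μ d : ℝ) * (psi d)⁻¹ * (d : ℝ) ^ (-(1 / 2 : ℝ)) * (Real.log (M / d) / Real.log M) ^ 2) *
        ((if m.Coprime d then W m else 0) * logWeight (M / d) m) * Real.sqrt m := by
  have hd0 : d ≠ 0 := by omega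
  have hm0 : m ≠ 0 := by omega
  have hdR : (0 : ℝ) < d := by exact_mod_cast hd
  have hmR : (0 : ℝ) < m := by exact_mod_cast hm
  have hunfold : mollifierCoeff (X ^ 2) M (d * m) =
      (μ (d * m) : ℝ) * ((psi (d * m))⁻¹ * ((d * m : ℕ) : ℝ) ^ (-(1 / 2 : ℝ)) *
        (Real.log (M / ((d * m : ℕ) : ℝ)) / Real.log M) ^ 2) := by
    simp only [mollifierCoeff, eval_pow, eval_X]
  rw [hunfold]
  by_cases hcop : m.Coprime d
  · rw [if_pos hcop, logWeight, if_pos hmM, W_apply'' hm0,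
      ArithmeticFunction.isMultiplicative_moebius.map_mul_of_coprime hcop.symm,
      psi_mul_of_coprime hd0 hm0 hcop.symm]
    push_cast
    have hlog : Real.log (M / ((d : ℝ) * m)) = Real.log (M / d / m) := by rw [div_div]
    have hpow : ((d : ℝ) * m) ^ (-(1 / 2 : ℝ)) = (d : ℝ) ^ (-(1 / 2 : ℝ)) * (m : ℝ) ^ (-(1 / 2 : ℝ)) :=
      Real.mul_rpow hdR.le hmR.le
    have hm' : (m : ℝ) ^ (-(1 / 2 : ℝ)) = Real.sqrt m / m := by
      rw [Real.sqrt_eq_rpow, eq_div_iff hmR.ne', ← Real.rpow_add_one hmR.ne']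
      norm_num
    have hψd : psi d ≠ 0 := by have := one_le_psi d; positivity
    have hψm : psi m ≠ 0 := by have := one_le_psi m; positivity
    rw [hlog, hpow, hm']
    field_simp
  · have hμ : (μ (d * m) : ℝ) = 0 := by
      exact_mod_cast ArithmeticFunction.moebius_eq_zero_of_not_squarefree (not_squarefree_mul_of_not_coprime hcop)
    rw [hμ, if_neg hcop]
    simp

/-- **One divisor layer of a single sum.** For `d ≥ 1`, `log(M/d) ≠ 0` and any `F`:
`Σ_{l≤⌊M⌋, d∣l} c_l(M)·F(l) = A_d(M)·Σ_{m≤⌊M/d⌋} ((𝟙[(m,d)=1]W(m))·logWeight (M/d) m)·(√m·F(dm))`,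
`A_d(M) = μ(d)ψ(d)⁻¹d^{−1/2}(log(M/d)/log M)²`. [folklore] -/
theorem sum_filter_dvd_mollifierCoeff_eq {M : ℝ} {d : ℕ} (hd : 1 ≤ d)
    (hMd : Real.log (M / d) ≠ 0) (F : ℕ → ℝ) :
    ∑ l ∈ (Icc 1 ⌊M⌋₊).filter (fun l : ℕ ↦ d ∣ l), mollifierCoeff (X ^ 2) M l * F l =
      ((μ d : ℝ) * (psi d)⁻¹ * (d : ℝ) ^ (-(1 / 2 : ℝ)) * (Real.log (M / d) / Real.log M) ^ 2) *
        ∑ m ∈ Icc 1 ⌊M / d⌋₊, ((if m.Coprime d then W m else 0) * logWeight (M / d) m) *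
          (Real.sqrt m * F (d * m)) := by
  rw [sum_Icc_filter_dvd_eq_sum_div (by omega : 0 < d), ← Nat.floor_div_natCast, Finset.mul_sum]
  refine Finset.sum_congr rfl fun m hm ↦ ?_
  rw [Finset.mem_Icc] at hm
  rw [mollifierCoeff_X_sq_mul_eq hd hm.1 hm.2 hMd]
  ring

/-- **One divisor layer `(d₁,d₂)` of the pair sum** — the input shape of `mellinBump_coprime_bv` (`M_i = M/d_i`):
`Σ_{l≤⌊M⌋,d₁∣l} Σ_{m≤⌊M⌋,d₂∣m} c_l c_m·F(l·m)
   = A_{d₁}A_{d₂}·Σ_{a≤⌊M/d₁⌋} Σ_{b≤⌊M/d₂⌋} (w₁λ₁)(a)·(w₂λ₂)(b)·(√a√b·F(d₁a·d₂b))`. [folklore] -/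
theorem sum_sum_filter_dvd_mollifierCoeff_eq {M : ℝ} {d₁ d₂ : ℕ} (hd₁ : 1 ≤ d₁) (hd₂ : 1 ≤ d₂)
    (hMd₁ : Real.log (M / d₁) ≠ 0) (hMd₂ : Real.log (M / d₂) ≠ 0) (F : ℕ → ℝ) :
    ∑ l ∈ (Icc 1 ⌊M⌋₊).filter (fun l : ℕ ↦ d₁ ∣ l), ∑ m ∈ (Icc 1 ⌊M⌋₊).filter (fun m : ℕ ↦ d₂ ∣ m),
        mollifierCoeff (X ^ 2) M l * mollifierCoeff (X ^ 2) M m * F (l * m) =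
      (((μ d₁ : ℝ) * (psi d₁)⁻¹ * (d₁ : ℝ) ^ (-(1 / 2 : ℝ)) * (Real.log (M / d₁) / Real.log M) ^ 2) *
        ((μ d₂ : ℝ) * (psi d₂)⁻¹ * (d₂ : ℝ) ^ (-(1 / 2 : ℝ)) * (Real.log (M / d₂) / Real.log M) ^ 2)) *
        ∑ a ∈ Icc 1 ⌊M / d₁⌋₊, ∑ b ∈ Icc 1 ⌊M / d₂⌋₊,
          ((if a.Coprime d₁ then W a else 0) * logWeight (M / d₁) a) *
            ((if b.Coprime d₂ then W b else 0) * logWeight (M / d₂) b) *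
              (Real.sqrt a * Real.sqrt b * F (d₁ * a * (d₂ * b))) := by
  have hinner : ∀ l : ℕ, ∑ m ∈ (Icc 1 ⌊M⌋₊).filter (fun m : ℕ ↦ d₂ ∣ m),
      mollifierCoeff (X ^ 2) M l * mollifierCoeff (X ^ 2) M m * F (l * m) =
      mollifierCoeff (X ^ 2) M l *
        (((μ d₂ : ℝ) * (psi d₂)⁻¹ * (d₂ : ℝ) ^ (-(1 / 2 : ℝ)) * (Real.log (M / d₂) / Real.log M) ^ 2) *
          ∑ b ∈ Icc 1 ⌊M / d₂⌋₊, ((if b.Coprime d₂ then W b else 0) * logWeight (M / d₂) b) *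
            (Real.sqrt b * F (l * (d₂ * b)))) := by
    intro l
    rw [← sum_filter_dvd_mollifierCoeff_eq hd₂ hMd₂ (fun m ↦ F (l * m)), Finset.mul_sum]
    exact Finset.sum_congr rfl fun m _ ↦ by ring
  simp_rw [hinner]
  have h2 := sum_filter_dvd_mollifierCoeff_eq hd₁ hMd₁ (fun l ↦
    (((μ d₂ : ℝ) * (psi d₂)⁻¹ * (d₂ : ℝ) ^ (-(1 / 2 : ℝ)) * (Real.log (M / d₂) / Real.log M) ^ 2) *
      ∑ b ∈ Icc 1 ⌊M / d₂⌋₊, ((if b.Coprime d₂ then W b else 0) * logWeight (M / d₂) b) *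
        (Real.sqrt b * F (l * (d₂ * b)))))
  rw [h2]
  simp only [Finset.mul_sum]
  refine Finset.sum_congr rfl fun a _ ↦ Finset.sum_congr rfl fun b _ ↦ ?_
  ring

end Summit.Parity.GeneralizedHardyLittlewood.Theorems.BeyondDiagonalBeatsQuarter.MellinBump
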